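import Literature.NumberTheory.EllipticCurves.Kato2004.IwasawaH1ReductionPk
import HarnessLib

/-!
# Kato 2004 §13.8: the reduction `red_{p^k} : H¹(U, T_pW) → H¹(U, W[p^k])` is `ℤ_p`-semilinear

Topic `NumberTheory/EllipticCurves`, sub-directory `Kato2004` (namespace = path). `Proofs`-style
sequel of `IwasawaH1ReductionPk.lean` (theorems only: no definition, no named fact, no instance).

The levelwise reduction `Kato2004.reduceH1Pk W p k U : H¹(U, T_pW) →+ H¹(U, W[p^k])` (change of
coefficients `T → T/p^k`, Kato §13.8) is recorded in the tree as an ADDITIVE map between Mathlib's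
continuous cohomology groups of a `ℤ_p`-representation and of a `ℤ`-representation. This file adds
its compatibility with the `ℤ_p`-module structure of the source:

* `mapH1AddHom_smul_of_map_smul` (generic, two coefficient rings): if an additive continuous
  equivariant `f : X → Y` satisfies `f (c • x) = n • f x` for a scalar `c` of `X` and an integer `n`,
  then `f_* (c • a) = n • f_* a` on `H¹`;
* **`reduceH1Pk_smul`** — `red_{p^k} (c • x) = (c mod p^k) • red_{p^k} x` for `c ∈ ℤ_p`, where
  `c mod p^k = (PadicInt.toZModPow k c).val ∈ ℕ` acts on the `p^k`-torsion group `H¹(U, W[p^k])`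
  (the `ℤ_p`-action on `T_pW` is componentwise `(c • a)_k = (c mod p^k) • a_k`, tree
  `TateModule.proj_smul`); with the natural-number and integer casts `reduceH1Pk_natCast_smul`,
  `reduceH1Pk_intCast_smul`.

This is the «`ℤ_p`-semilinear in the class» hypothesis of the `k`-glue
`SignedKatoOffTwo.LayerPairingLimit.exists_linear_pairing_of_compatible` (K3 of the BSD cell, item
stmt-BirchSwinnertonDyer-20308) for any finite-coefficient pairing built from `red_{p^k}`.

References: K. Kato, Astérisque 295 (2004), §13.8 (pp. 228–229) [Kato2004Asterisque]; J.-P. Serre,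
*Galois Cohomology* (1997), I §2.2 [SerreGaloisCohomology1997].
-/

noncomputable section

open Field CategoryTheory
open Literature.NumberTheory.GaloisRepresentations
open Literature.NumberTheory.EllipticCurves Literature.NumberTheory.EllipticCurves.Kato2004
open Literature.NumberTheory.EllipticCurves.Kato2004.EulerSystemValues
open WeierstrassCurve (geomPoints geomTorsion)

universe u u' v

/-! ## §1 Generic: `f_*` and scalars -/

namespace Literature.NumberTheory.GaloisRepresentations

section Semilinear

variable {R : Type u} [Ring R] [TopologicalSpace R] {R' : Type u'} [Ring R'] [TopologicalSpace R']
variable {G : Type v} [Group G] [TopologicalSpace G] [IsTopologicalGroup G]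
variable {X : TopRep.{v} R G} {Y : TopRep.{v} R' G}

/-- **`f_*` is semilinear for scalars that `f` turns into integers**: if `f (c • x) = n • f x` for all
`x` (`c` a scalar of `X`, `n ∈ ℤ`), then `f_* (c • a) = n • f_* a` on `H¹_cont(G, ·)` (on cocycles,
`f ∘ (c • φ) = n • (f ∘ φ)`). [cite: SerreGaloisCohomology1997, I §2.2] -/
theorem mapH1AddHom_smul_of_map_smul (f : X →+ Y) (hf : Continuous f)
    (hρ : ∀ (g : G) (x : X), f (X.ρ g x) = Y.ρ g (f x)) {c : R} {n : ℤ}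
    (hc : ∀ x : X, f (c • x) = n • f x) (a : continuousCohomology 1 X) :
    mapH1AddHom X Y f hf hρ (c • a) = n • mapH1AddHom X Y f hf hρ a := by
  obtain ⟨φ, rfl⟩ := oneCocycleClass_surjective X a
  rw [← oneCocycleClass_smul, mapH1AddHom_oneCocycleClass, mapH1AddHom_oneCocycleClass,
    ← oneCocycleClassₗ_apply, ← oneCocycleClassₗ_apply, ← map_zsmul]
  congr 1
  refine Subtype.ext (ContinuousMap.ext fun g ↦ ?_)
  rw [contOneCocycles.pushAddHom_apply, Submodule.coe_smul, ContinuousMap.smul_apply, hc,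
    Submodule.coe_smul_of_tower, ContinuousMap.smul_apply, contOneCocycles.pushAddHom_apply]

end Semilinear

end Literature.NumberTheory.GaloisRepresentations

/-! ## §2 `red_{p^k}` and the `ℤ_p`-module structure of `H¹(U, T_pW)` -/

namespace Literature.NumberTheory.EllipticCurves.Kato2004

section Reduction

variable (W : WeierstrassCurve ℚ) [W.IsElliptic] (p : ℕ) [Fact p.Prime] (k : ℕ)

omit [W.IsElliptic] in
/-- `tateModPk (c • a) = (c mod p^k) • tateModPk a`: the `ℤ_p`-action on `T_pW` is componentwise
(`TateModule.proj_smul`). [cite: Kato2004Asterisque, §13.8 (p. 228)] -/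
theorem tateModPk_padicInt_smul (c : ℤ_[p]) (a : W.tateModule p) :
    tateModPk W p k (c • a) = ((PadicInt.toZModPow k c).val : ℤ) • tateModPk W p k a :=
  Subtype.ext (by
    rw [coe_tateModPk_apply, TateModule.proj_smul, natCast_zsmul, AddSubgroupClass.coe_nsmul,
      coe_tateModPk_apply])

variable [ContinuousSMul ℤ_[p] (W.tateModule p)]

/-- **`red_{p^k}` is `ℤ_p`-semilinear**: `red_{p^k} (c • x) = (c mod p^k) • red_{p^k} x` for
`c ∈ ℤ_p` and `x ∈ H¹(U, T_pW)`, with `c mod p^k = (PadicInt.toZModPow k c).val` acting through `ℤ`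
on `H¹(U, W[p^k])`. [cite: Kato2004Asterisque, §13.8 (p. 228)] -/
theorem reduceH1Pk_smul (U : Subgroup (absoluteGaloisGroup ℚ)) (c : ℤ_[p])
    (x : H1 (tateRep W p) U) :
    reduceH1Pk W p k U (c • x) =
      ((PadicInt.toZModPow k c).val : ℤ) • reduceH1Pk W p k U x :=
  mapH1AddHom_smul_of_map_smul _ _ _ (fun a ↦ tateModPk_padicInt_smul W p k c a) x

/-- `red_{p^k} (n • x) = n • red_{p^k} x` for `n ∈ ℕ` (additivity). [cite: Kato2004Asterisque, §13.8 (p. 228)] -/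
theorem reduceH1Pk_nsmul (U : Subgroup (absoluteGaloisGroup ℚ)) (n : ℕ) (x : H1 (tateRep W p) U) :
    reduceH1Pk W p k U (n • x) = n • reduceH1Pk W p k U x :=
  map_nsmul _ n x

/-- `red_{p^k} (n • x) = n • red_{p^k} x` for `n ∈ ℤ` (additivity). [cite: Kato2004Asterisque, §13.8 (p. 228)] -/
theorem reduceH1Pk_zsmul (U : Subgroup (absoluteGaloisGroup ℚ)) (n : ℤ) (x : H1 (tateRep W p) U) :
    reduceH1Pk W p k U (n • x) = n • reduceH1Pk W p k U x :=
  map_zsmul _ n x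

/-- The residue of `red_{p^k} (c • x)` only depends on `c mod p^k`: as an element of `ZMod (p^k)`
acting on the `p^k`-torsion values, `red_{p^k} (c • x) = (toZModPow k c : ZMod (p^k)).val • red_{p^k} x`
(natural-number form of `reduceH1Pk_smul`). [cite: Kato2004Asterisque, §13.8 (p. 228)] -/
theorem reduceH1Pk_smul_nat (U : Subgroup (absoluteGaloisGroup ℚ)) (c : ℤ_[p])
    (x : H1 (tateRep W p) U) :
    reduceH1Pk W p k U (c • x) = (PadicInt.toZModPow k c).val • reduceH1Pk W p k U x := by
  rw [reduceH1Pk_smul, natCast_zsmul]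

end Reduction

end Literature.NumberTheory.EllipticCurves.Kato2004
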